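import Literature.NumberTheory.EllipticCurves.BSDRootNumberSmallConductorRankProofs
import Literature.NumberTheory.EllipticCurves.BSDAverageRankFiveSelmer
import HarnessLib

/-!
# BirchSwinnertonDyer — rank ≥ 2 observatory: the per-curve certificate, Lean side

HONEST FRAMING: per-curve certified theorems and census instruments; no claim on BSD in rank ≥ 2.

This file is the kernel-checked ASSEMBLY of a rank-2 / rank-3 certificate for ONE elliptic curve
`E/ℚ` (the observatory's certificate schema `bsdr2-cert-1/v1` ⨉ `bsdr2-engineB/v0`, two independent
engines per field). For a curve of algebraic rank `r ∈ {2, 3}` the equality `r_an(E) = rank_ℤ E(ℚ)`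
follows from five inputs, each entering as a NAMED HYPOTHESIS of the per-curve theorem (never an
axiom, never a vendored fact):

* `hGZK : rank_eq_analyticRank_of_analyticRank_le_one` — Gross–Zagier–Kolyvagin (the tree's named
  fact bsd.S17, `Literature.NumberTheory.EllipticCurves.LeadingTerm`): `r_an ≤ 1 ⇒ rank = r_an`;
* `hlow : r ≤ rank_ℤ E(ℚ)` — certificate field `rank_lower`: `r` listed generators and a saturation
  witness at an auxiliary prime `q` (the images of all `2^r − 1` non-trivial `𝔽₂`-combinations in
  `Ẽ(𝔽_q)/2Ẽ(𝔽_q)` are non-zero), two engines with independently counted `#Ẽ(𝔽_q)`; the per-curve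
  files re-count `#Ẽ(𝔽_q)` IN THE KERNEL, but the independence conclusion stays a hypothesis (Mathlib
  has no reduction map `E(ℚ) → Ẽ(𝔽_q)` yet);
* `hup : rank_ℤ E(ℚ) ≤ r`, or its descent form
  `hsel : #Sel^(2)(E/ℚ) ≤ 2^r · #E(ℚ)[2]` — certificate field `rank_upper` (2-descent: Cremona's
  `mwrank` as recorded in ecdata, PARI `ellrank` in engine P); the descent form is converted here by
  the PROVED inequality `2^rank · #E(ℚ)[2] ≤ #Sel^(2)`
  (`WeierstrassCurve.pow_mordellWeilRank_mul_card_torsionBy_le_card_selmerGroup`);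
* `hLr : iteratedDeriv r L(E,s)|_{s=1} ≠ 0` — certificate field `L2` / `L3`: a certified interval
  for `L^{(r)}(E,1)/r!` excluding `0`, two engines (Arb/PARI `lfun` in engine P; integer-interval
  evaluation of the completed-`Λ` series with independently computed `a_p` in engine B);
* `hw : w(E) = −1` (rank 3 only) — certificate field `root_number` (PARI `ellrootno`; theta-series
  functional-equation test in engine B); `WeierstrassCurve.rootNumber` is defined analytically in the
  tree, so this stays a hypothesis.

Given these, `analyticRank_eq_mordellWeilRank_of_rank2Certificate` /
`…_of_rank3Certificate` conclude `E.analyticRank = E.mordellWeilRank` through the tree theorem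
`analyticRank_eq_mordellWeilRank_of_certificate` (Cremona 1997 §2.13: `L^{(r)}(E,1) ≠ 0` gives
`r_an ≤ r`; GZK excludes `r_an ≤ 1`; for `r = 3` the sign excludes `r_an = 2`). The junk-robust step
`L^{(n)}(E,1) ≠ 0 ⇒ r_an ≤ n` (`analyticRank_le_of_iteratedDeriv_ne_zero`) is the `n`-indexed form
of `Theorems.analyticRank_le_mordellWeilRank_of_iteratedDeriv_ne_zero` (route LeadingTerm).

Per-curve files `Rank2Observatory<Label>.lean` supply: the minimal model, `Δ` and `IsElliptic`
computed, the listed generators ON the curve (kernel), `#Ẽ(𝔽_q)` at the witness primes (kernel point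
count, Euler criterion), and the certificate's sha256 / job ids / TSV-row hash in the docstring.
Census statements are DATA (docstrings), never theorems. A disagreement between the two engines is
never a theorem here: such a curve has no file until the referee signs the anomaly record.

References: J. E. Cremona, *Algorithms for Modular Elliptic Curves* (2nd ed. 1997) §2.13, §3.5–3.6
and Ch. IV; B. H. Gross, D. Zagier, Invent. Math. 84 (1986); V. A. Kolyvagin, Izv. 52 (1988) /
Progr. Math. 87 (1990) (tree fact bsd.S17 via `Darmon2004` Thm. 3.22); J. H. Silverman, AEC
Thm. X.4.2 (descent inequality).
-/

-- single-conjunct summit: `Summit.BirchSwinnertonDyer.BirchSwinnertonDyer.…` repeats the name by design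
set_option linter.dupNamespace false

noncomputable section

open scoped Classical
open scoped AddSubgroup

namespace Summit.BirchSwinnertonDyer.BirchSwinnertonDyer.Rank2Observatory

open Literature.NumberTheory.EllipticCurves WeierstrassCurve

variable (W : WeierstrassCurve ℚ) [W.IsElliptic]

omit [W.IsElliptic] in
/-- **`L^{(n)}(E,1) ≠ 0 ⇒ r_an(E) ≤ n`**, junk-robust for the tree's `analyticRank`
(`analyticOrderNatAt`, which is `0` off the analytic locus / at infinite order): if `r_an > n` then
`r_an ≥ 1` forces `L(E,s)` analytic at `1` of finite order `r_an`, and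
`natCast_le_analyticOrderAt_iff_iteratedDeriv_eq_zero` kills the `n`-th derivative.
(Cremona 1997, §2.13: the order of vanishing is read off the first non-vanishing Taylor
coefficient.) [folklore] -/
theorem analyticRank_le_of_iteratedDeriv_ne_zero {n : ℕ}
    (hder : iteratedDeriv n W.entireLFunction 1 ≠ 0) : W.analyticRank ≤ n := by
  by_contra hlt
  push Not at hlt
  have han : AnalyticAt ℂ W.entireLFunction 1 := by
    by_contra h
    have : W.analyticRank = 0 := by
      unfold WeierstrassCurve.analyticRank
      exact analyticOrderNatAt_of_not_analyticAt h
    omega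
  have htop : analyticOrderAt W.entireLFunction 1 ≠ ⊤ := by
    intro h
    have : W.analyticRank = 0 := by
      unfold WeierstrassCurve.analyticRank analyticOrderNatAt
      rw [h]; rfl
    omega
  have hcast : ((W.analyticRank : ℕ) : ℕ∞) = analyticOrderAt W.entireLFunction 1 := by
    unfold WeierstrassCurve.analyticRank
    exact Nat.cast_analyticOrderNatAt htop
  exact hder ((natCast_le_analyticOrderAt_iff_iteratedDeriv_eq_zero han).mp hcast.le n hlt)

/-- **2-descent upper bound, Selmer form**: `#Sel^(2)(E/ℚ) ≤ 2^r · #E(ℚ)[2] ⇒ rank_ℤ E(ℚ) ≤ r`,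
from the proved descent inequality `2^rank · #E(ℚ)[2] ≤ #Sel^(2)(E/ℚ)` (Silverman AEC X.4.2) and
`#E(ℚ)[2] = 2^t ≥ 1` (Mordell–Weil). [cite: SilvermanAEC2009, Thm X.4.2] -/
theorem mordellWeilRank_le_of_card_selmerGroup_two_le {r : ℕ}
    (hsel : Nat.card (W.selmerGroup 2) ≤ 2 ^ r * Nat.card (W.toAffine.Point[(2 : ℤ)])) :
    W.mordellWeilRank ≤ r := by
  haveI : Fact (Nat.Prime 2) := ⟨Nat.prime_two⟩
  -- `((2 : ℕ) : ℤ)` and `(2 : ℤ)` are definitionally equal, so the `ℚ`-bridged tree lemmas apply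
  have hdesc : 2 ^ W.mordellWeilRank * Nat.card (W.toAffine.Point[(2 : ℤ)]) ≤
      Nat.card (W.selmerGroup 2) :=
    pow_mordellWeilRank_mul_card_torsionBy_le_rat W 2
  obtain ⟨t, ht⟩ := exists_natCard_torsionBy_eq_pow_rat W 2
  have ht' : Nat.card (W.toAffine.Point[(2 : ℤ)]) = 2 ^ t := ht
  have hpos : 0 < Nat.card (W.toAffine.Point[(2 : ℤ)]) := by
    rw [ht']; positivity
  have hchain : 2 ^ W.mordellWeilRank * Nat.card (W.toAffine.Point[(2 : ℤ)]) ≤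
      2 ^ r * Nat.card (W.toAffine.Point[(2 : ℤ)]) := le_trans hdesc hsel
  exact (Nat.pow_le_pow_iff_right (by norm_num)).mp (Nat.le_of_mul_le_mul_right hchain hpos)

/-- **Rank-2 certificate ⇒ `r_an(E) = rank_ℤ E(ℚ)`** (Cremona 1997 §2.13 / Ch. IV "Some remarks on
the computations", Kolyvagin form): two independent points (`hlow`), a 2-descent upper bound
(`hup`), `L''(E,1) ≠ 0` (`hL2`) and Gross–Zagier–Kolyvagin (`hGZK`).
[cite: CremonaAlgorithms1997, §2.13] [cite: Darmon2004, Thm. 3.22] -/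
theorem analyticRank_eq_mordellWeilRank_of_rank2Certificate
    (hGZK : rank_eq_analyticRank_of_analyticRank_le_one)
    (hlow : 2 ≤ W.mordellWeilRank) (hup : W.mordellWeilRank ≤ 2)
    (hL2 : iteratedDeriv 2 W.entireLFunction 1 ≠ 0) :
    W.analyticRank = W.mordellWeilRank := by
  have h2 : W.mordellWeilRank = 2 := le_antisymm hup hlow
  refine analyticRank_eq_mordellWeilRank_of_certificate W hGZK (by omega) ?_ (by omega)
  rw [h2]
  exact analyticRank_le_of_iteratedDeriv_ne_zero W hL2

/-- Rank-2 certificate, descent form of the upper bound (`#Sel^(2) ≤ 4 · #E(ℚ)[2]`).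
[cite: CremonaAlgorithms1997, §2.13] [cite: SilvermanAEC2009, Thm X.4.2] -/
theorem analyticRank_eq_mordellWeilRank_of_rank2Certificate_selmer
    (hGZK : rank_eq_analyticRank_of_analyticRank_le_one)
    (hlow : 2 ≤ W.mordellWeilRank)
    (hsel : Nat.card (W.selmerGroup 2) ≤ 2 ^ 2 * Nat.card (W.toAffine.Point[(2 : ℤ)]))
    (hL2 : iteratedDeriv 2 W.entireLFunction 1 ≠ 0) :
    W.analyticRank = W.mordellWeilRank :=
  analyticRank_eq_mordellWeilRank_of_rank2Certificate W hGZK hlow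
    (mordellWeilRank_le_of_card_selmerGroup_two_le W hsel) hL2

/-- **Rank-3 certificate ⇒ `r_an(E) = rank_ℤ E(ℚ)`** (Buhler–Gross–Zagier 1985 for 5077a1; Cremona
1997 §2.13): three independent points (`hlow`), a 2-descent upper bound (`hup`), `L'''(E,1) ≠ 0`
(`hL3`), root number `−1` (`hw`, which excludes `r_an = 2` by parity) and Gross–Zagier–Kolyvagin.
[cite: CremonaAlgorithms1997, §2.13] [cite: Darmon2004, Thm. 3.22] -/
theorem analyticRank_eq_mordellWeilRank_of_rank3Certificate
    (hGZK : rank_eq_analyticRank_of_analyticRank_le_one)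
    (hlow : 3 ≤ W.mordellWeilRank) (hup : W.mordellWeilRank ≤ 3)
    (hL3 : iteratedDeriv 3 W.entireLFunction 1 ≠ 0) (hw : W.rootNumber = -1) :
    W.analyticRank = W.mordellWeilRank := by
  have h3 : W.mordellWeilRank = 3 := le_antisymm hup hlow
  refine analyticRank_eq_mordellWeilRank_of_certificate W hGZK (by omega) ?_ (fun _ ↦ hw)
  rw [h3]
  exact analyticRank_le_of_iteratedDeriv_ne_zero W hL3

/-- Rank-3 certificate, descent form of the upper bound (`#Sel^(2) ≤ 8 · #E(ℚ)[2]`).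
[cite: CremonaAlgorithms1997, §2.13] [cite: SilvermanAEC2009, Thm X.4.2] -/
theorem analyticRank_eq_mordellWeilRank_of_rank3Certificate_selmer
    (hGZK : rank_eq_analyticRank_of_analyticRank_le_one)
    (hlow : 3 ≤ W.mordellWeilRank)
    (hsel : Nat.card (W.selmerGroup 2) ≤ 2 ^ 3 * Nat.card (W.toAffine.Point[(2 : ℤ)]))
    (hL3 : iteratedDeriv 3 W.entireLFunction 1 ≠ 0) (hw : W.rootNumber = -1) :
    W.analyticRank = W.mordellWeilRank :=
  analyticRank_eq_mordellWeilRank_of_rank3Certificate W hGZK hlow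
    (mordellWeilRank_le_of_card_selmerGroup_two_le W hsel) hL3 hw

end Summit.BirchSwinnertonDyer.BirchSwinnertonDyer.Rank2Observatory
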